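import Summits.QuantumFields.YangMills.Theses.InfraredLiouville

/-!
# Birth skeleton — crux `IRCompactness` (stmt-QuantumFields-9707), route `InfraredLiouville`

`IRCompactness` (wherever some connected torus time-correlation of Wilson's lattice theory at
coupling `β` fails super-polynomial decay, a NON-vacuum infrared limit point of the typed class
exists) is reduced to three named stubs and a kernel-checked composition `IRCompactness_of`.

* `stub_twoPointScales` — GOOD SCALES (the two-point half; "compactness of two-point data is
  free"): failure of super-polynomial decay of the `(A, B)` correlation at `β` yields ONE species
  `s₀` and an infrared scheme at `β` (constant coupling, polynomially bounded renormalisation,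
  exact centring) renormalising every other species to zero, whose smeared TWO-point functions are
  uniformly-in-`k` tempered of finite order on `⁰𝒮` and which is non-degenerate on one fixed
  off-diagonal tensor. Mechanism: reflection positivity makes `t ↦ ⟨θH · τ_t H⟩` completely
  monotone for spatially smeared `H`; `r`-good scales `n_k` (`W(m) ≤ (n_k/m)^r W(n_k)` for
  `m ≤ n_k`) are infinitely many iff decay is not super-polynomial; the normalisation
  `c_k² W(n_k) ≍ 1` is polynomially bounded in `a_k⁻¹ = n_k` exactly because decay fails
  polynomially; flatness of `Φ ∈ ⁰𝒮` at the diagonal absorbs the factor `(a_k |z|)^{-r}`.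
* `stub_noIntermittency` — NO INFRARED INTERMITTENCY (the load-bearing a-priori estimate): at a
  coupling where a two-point-tempered, non-degenerate single-species infrared scheme exists, some
  single-species infrared scheme (sparser scales / another species / another polynomial
  normalisation allowed) has ALL `n`-point functions uniformly tempered of finite order on `⁰𝒮`
  and is still non-degenerate. This is the "needs IR temperedness of all n-point functions under
  the two-point normalisation" clause of the crux docstring, isolated as an estimate.
* `stub_extraction` — SEQUENTIAL COMPACTNESS (functional analysis; true): a single-species scheme
  with uniformly tempered `n`-point functions has a subsequence along which all joint smeared
  functions converge on off-diagonal real tensors to a `LabelledSchwingerFamily` (countably many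
  non-zero strings; diagonal extraction on a countable dense subset of the separable space
  `⁰𝒮 ∩ span{real tensors}`; equicontinuity from the uniform bound; Hahn–Banach extension of the
  limit, dominated by `C · schwartzNorm s`; linearity on the span is FORCED by the bound at
  `Φ = 0`, so no Fubini is needed).

`IRCompactness_of`: reindex the tempered scheme along the extracted subsequence
(`reindex`, again a `SpeciesScheme`), transfer the three bookkeeping clauses pointwise in `k`,
read convergence off `stub_extraction` (definitionally the same lattice functions), and get
`S n σ F ≠ 0` from the uniform lower bound `δ` carried through the limit (`ge_of_tendsto'`).

Disproof used: none on file (no `Disproof.lean` for this crux at registration time).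
-/

namespace Summit.QuantumFields.YangMills.Cruxes.IRCompactness.Birth

open Literature.MathematicalPhysics.QuantumFieldTheory Literature.MathematicalPhysics.QuantumLattice
  Literature.MathematicalPhysics.AQFT
open Filter Topology MeasureTheory
open scoped SchwartzMap

noncomputable section

section Interface

variable {G : Type} [Group G] [TopologicalSpace G] [IsTopologicalGroup G] [CompactSpace G]
  [MeasurableSpace G] [BorelSpace G]

/-! ### Interface predicates (stated over existing declarations only) -/

/-- `sch` is an INFRARED scheme of `r` AT coupling `β`: constant coupling `β_k = β`, polynomially
bounded multiplicative renormalisations `|c_s(k)| ≤ K · a_k^{-p}`, exact centring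
`m_s(k) = ⟨s⟩` on the torus of side `2L_k + 1` — verbatim the three bookkeeping clauses of
`IRCompactness` / `IRLiouville`. -/
def IsIRSchemeAt (r : LatticeRep G) (β : ℝ) (sch : SpeciesScheme (YMSpecies G)) : Prop :=
  (∀ k : ℕ, sch.β k = β) ∧
    (∀ s : YMSpecies G, ∃ (p : ℕ) (K : ℝ), ∀ k : ℕ, |sch.c s k| ≤ K * (sch.a k)⁻¹ ^ p) ∧
      ∀ (s : YMSpecies G) (k : ℕ), sch.m s k =
        ∫ U, s.F (torusLift (sch.side k) U) ∂(wilsonMeasure (d := 4) (L := sch.side k) r.ρ (sch.β k))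

/-- SINGLE-SPECIES normalisation: every species other than `s₀` is renormalised to zero (so every
lattice function of a string leaving `s₀` vanishes identically, and only countably many strings
carry information). -/
def IsSingleSpecies (sch : SpeciesScheme (YMSpecies G)) (s₀ : YMSpecies G) : Prop :=
  ∀ s : YMSpecies G, s ≠ s₀ → ∀ k : ℕ, sch.c s k = 0

/-- UNIFORM TEMPEREDNESS OF FINITE ORDER ON `⁰𝒮` of the lattice `n`-point functions of the string
`σ` along `sch`: ONE Schwartz order `s` and ONE constant `C` such that for EVERY step `k` and
every finite combination `Φ = ∑ⱼ cⱼ Fⱼ` of real tensors `Fⱼ = ⊗ᵢ f_{ji}` lying in `⁰𝒮`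
(`IsOffDiagonal Φ`), `‖∑ⱼ cⱼ ⟨∏ᵢ Φ^{σᵢ}_k(f_{ji})⟩_k‖ ≤ C · |Φ|_s` (`schwartzNorm s Φ`). In words:
the lattice `n`-point distributions restricted to `⁰𝒮` are bounded in `𝒮'` of order `≤ s`
uniformly in `k` — written on the span of real tensors so that only `latticeSchwinger` occurs
(at `Φ = 0` the bound forces the combination of lattice values to vanish: consistency). -/
def IsUniformlyTemperedAt (r : LatticeRep G) (sch : SpeciesScheme (YMSpecies G)) (n : ℕ)
    (σ : Fin n → YMSpecies G) : Prop :=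
  ∃ (s : ℕ) (C : ℝ), ∀ (k m : ℕ) (c : Fin m → ℂ)
    (f : Fin m → Fin n → 𝓢(EuclideanSpace ℝ (Fin 4), ℝ))
    (F : Fin m → 𝓢((Fin n → EuclideanSpace ℝ (Fin 4)), ℂ)),
    (∀ j, IsTensorOf (F j) (fun i => ofRealTest (f j i))) → IsOffDiagonal (∑ j, c j • F j) →
      ‖∑ j, c j * ((latticeSchwinger r.ρ sch (fun s => s.F) k n σ (f j) : ℝ) : ℂ)‖ ≤
        C * schwartzNorm s (∑ j, c j • F j)

/-- NON-DEGENERACY along the whole scheme: one fixed off-diagonal real tensor `F = ⊗ᵢ fᵢ`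
(some `n ≥ 1`, some string `σ`) on which the lattice `n`-point function stays bounded away from
zero for ALL steps `k` (survives every reindexing; passes to any limit). -/
def IsNondegenerate (r : LatticeRep G) (sch : SpeciesScheme (YMSpecies G)) : Prop :=
  ∃ n : ℕ, n ≠ 0 ∧ ∃ (σ : Fin n → YMSpecies G) (f : Fin n → 𝓢(EuclideanSpace ℝ (Fin 4), ℝ))
    (F : 𝓢((Fin n → EuclideanSpace ℝ (Fin 4)), ℂ)),
    IsTensorOf F (fun i => ofRealTest (f i)) ∧ IsOffDiagonal F ∧
      ∃ δ : ℝ, 0 < δ ∧ ∀ k : ℕ, δ ≤ |latticeSchwinger r.ρ sch (fun s => s.F) k n σ f|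

end Interface

/-! ### The three stubs -/

/-- **STUB 1 — good scales (two-point half).** Failure of super-polynomial decay (infinite-volume
form) of the connected `(A, B)` torus time-correlation at `β` ⇒ a species `s₀` and an infrared
scheme at `β` renormalising only `s₀`, non-degenerate, with uniformly tempered TWO-point functions
on `⁰𝒮`. Size M/L. Leans on: reflection positivity of Wilson's action (transfer matrix
`0 ≤ T ≤ 1`: spectral/complete monotonicity of `⟨θH τ_t H⟩`), Cauchy–Schwarz
`|corr_{AB}|² ≤ corr_{AA} corr_{BB}` to pass to an autocorrelation, the `r`-good-scale lemma for
sequences, flatness of `⁰𝒮` at the diagonal. Why it might fail: slow modes at spatial momentum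
`p ≠ 0` (staggered) carry axis non-decay but are averaged out by smooth smearing — the species may
have to change (`s₀ ∉ {A, B}`, e.g. products of translates), which needs a lower bound on a
four-point function; off-axis positivity of `W` is not given by RP (axes are a null set). -/
theorem stub_twoPointScales :
    ∀ (G : Type) [Group G] [TopologicalSpace G] [IsTopologicalGroup G] [CompactSpace G]
      [MeasurableSpace G] [BorelSpace G] (r : LatticeRep G) (β : ℝ) (A B : YMSpecies G),
      ¬ (∀ p : ℕ, ∃ C : ℝ, ∀ n : ℕ, ∃ S₀ : ℕ, ∀ S : ℕ, S₀ ≤ S →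
          (n : ℝ) ^ p * |latticeConnectedCorr r.ρ β (2 * S + 1) A.F B.F n| ≤ C) →
        ∃ (s₀ : YMSpecies G) (sch : SpeciesScheme (YMSpecies G)),
          IsIRSchemeAt r β sch ∧ IsSingleSpecies sch s₀ ∧ IsNondegenerate r sch ∧
            ∀ σ : Fin 2 → YMSpecies G, IsUniformlyTemperedAt r sch 2 σ := by
  sorry

/-- **STUB 2 — no infrared intermittency (load-bearing).** At a coupling `β` where SOME species
admits a non-degenerate, two-point-tempered, single-species infrared scheme, some species admits a
non-degenerate single-species infrared scheme at `β` ALL of whose `n`-point functions (`n ≥ 1`,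
every string) are uniformly tempered of finite order on `⁰𝒮` (new scales, species and polynomial
normalisation allowed). Size L; the crux's "needs IR temperedness of all `n`-point functions under
the two-point normalisation" as an a-priori estimate. Why it might fail: IR intermittency — higher
moments of the normalised centred field growing faster than any fixed polynomial normalisation can
tame while keeping one moment non-degenerate (no Gaussian/tree domination, no hypercontractivity
for gauge fields); where the crux is false this stub is false with it. -/
theorem stub_noIntermittency :
    ∀ (G : Type) [Group G] [TopologicalSpace G] [IsTopologicalGroup G] [CompactSpace G]
      [MeasurableSpace G] [BorelSpace G] (r : LatticeRep G) (β : ℝ) (s₀ : YMSpecies G)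
      (sch : SpeciesScheme (YMSpecies G)),
      IsIRSchemeAt r β sch → IsSingleSpecies sch s₀ → IsNondegenerate r sch →
        (∀ σ : Fin 2 → YMSpecies G, IsUniformlyTemperedAt r sch 2 σ) →
          ∃ (s₁ : YMSpecies G) (sch' : SpeciesScheme (YMSpecies G)),
            IsIRSchemeAt r β sch' ∧ IsSingleSpecies sch' s₁ ∧ IsNondegenerate r sch' ∧
              ∀ n : ℕ, n ≠ 0 → ∀ σ : Fin n → YMSpecies G, IsUniformlyTemperedAt r sch' n σ := by
  sorry

/-- **STUB 3 — extraction (sequential compactness; true, size M).** A single-species scheme whose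
`n`-point functions are uniformly tempered of finite order on `⁰𝒮` has a subsequence `φ` and a
`LabelledSchwingerFamily S` such that ALL joint smeared lattice functions converge along `φ` to
`S` on off-diagonal real tensors. Leans on: separability of `𝓢` (countable dense subset of
`⁰𝒮 ∩ span{real tensors}` per `n`), Bolzano–Weierstrass + diagonal extraction over countably
many sequences (`Filter.extraction_forall_of_eventually'`-type lemmas / `tendsto_subseq_of_bounded`),
equicontinuity from the uniform bound (the combination is well defined on the span because the
bound at `Φ = 0` kills it), Hahn–Banach dominated by the continuous seminorm `C · schwartzNorm s`,
strings leaving `s₀` are identically zero (`IsSingleSpecies`). No kernel theorem needed (values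
are only prescribed on off-diagonal tensors). -/
theorem stub_extraction :
    ∀ (G : Type) [Group G] [TopologicalSpace G] [IsTopologicalGroup G] [CompactSpace G]
      [MeasurableSpace G] [BorelSpace G] (r : LatticeRep G) (s₀ : YMSpecies G)
      (sch : SpeciesScheme (YMSpecies G)),
      IsSingleSpecies sch s₀ →
        (∀ n : ℕ, n ≠ 0 → ∀ σ : Fin n → YMSpecies G, IsUniformlyTemperedAt r sch n σ) →
          ∃ φ : ℕ → ℕ, StrictMono φ ∧
            ∃ S : LabelledSchwingerFamily (YMSpecies G) (EuclideanSpace ℝ (Fin 4)),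
              ∀ n : ℕ, n ≠ 0 → ∀ (σ : Fin n → YMSpecies G)
                (f : Fin n → 𝓢(EuclideanSpace ℝ (Fin 4), ℝ))
                (F : 𝓢((Fin n → EuclideanSpace ℝ (Fin 4)), ℂ)),
                IsTensorOf F (fun i => ofRealTest (f i)) → IsOffDiagonal F →
                  Tendsto (fun k : ℕ =>
                    ((latticeSchwinger r.ρ sch (fun s => s.F) (φ k) n σ f : ℝ) : ℂ))
                    atTop (𝓝 (S n σ F)) := by
  sorry

/-! ### Glue: reindexing a scheme along a subsequence -/

section Reindex

variable {ι : Type}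

/-- Reindexing a sequential scheme along a strictly increasing `φ : ℕ → ℕ` is again a scheme
(`a ∘ φ → 0`, `(a · L) ∘ φ → ∞`). -/
def reindex (sch : SpeciesScheme ι) (φ : ℕ → ℕ) (hφ : StrictMono φ) : SpeciesScheme ι where
  a k := sch.a (φ k)
  a_pos k := sch.a_pos (φ k)
  tendsto_a := sch.tendsto_a.comp hφ.tendsto_atTop
  β k := sch.β (φ k)
  L k := sch.L (φ k)
  tendsto_L := sch.tendsto_L.comp hφ.tendsto_atTop
  c s k := sch.c s (φ k)
  m s k := sch.m s (φ k)

end Reindex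

section ReindexLattice

variable {G : Type} [Group G] [TopologicalSpace G] [IsTopologicalGroup G] [CompactSpace G]
  [MeasurableSpace G] [BorelSpace G]

/-- The lattice functions of the reindexed scheme ARE those of the scheme at the selected steps
(definitional). -/
theorem latticeSchwinger_reindex (r : LatticeRep G) (sch : SpeciesScheme (YMSpecies G))
    (φ : ℕ → ℕ) (hφ : StrictMono φ) (k n : ℕ) (σ : Fin n → YMSpecies G)
    (f : Fin n → 𝓢(EuclideanSpace ℝ (Fin 4), ℝ)) :
    latticeSchwinger r.ρ (reindex sch φ hφ) (fun s => s.F) k n σ f =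
      latticeSchwinger r.ρ sch (fun s => s.F) (φ k) n σ f := rfl

/-- An infrared scheme at `β` stays one after reindexing (all three clauses are pointwise in `k`). -/
theorem IsIRSchemeAt.reindex {r : LatticeRep G} {β : ℝ} {sch : SpeciesScheme (YMSpecies G)}
    (h : IsIRSchemeAt r β sch) (φ : ℕ → ℕ) (hφ : StrictMono φ) :
    IsIRSchemeAt r β (reindex sch φ hφ) := by
  obtain ⟨hβ, hc, hm⟩ := h
  refine ⟨fun k => hβ (φ k), fun s => ?_, fun s k => hm s (φ k)⟩
  obtain ⟨p, K, hK⟩ := hc s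
  exact ⟨p, K, fun k => hK (φ k)⟩

end ReindexLattice

/-! ### The composition -/

/-- **Composition with explicit stub hypotheses** (the REAL proof; conclusion = the crux body VERBATIM, so
that `IRCompactness_of` below is the file's only theorem headed by the crux name, as
`ledger skeleton check` takes the first crux-headed theorem and admits no unregistered hypotheses):
good scales for one species, the no-intermittency upgrade to all `n`, extraction of a convergent
subsequence; the reindexed scheme is the witness, and non-degeneracy (`δ ≤ |·|` at every step)
passes to the limit, so the extracted family is not the vacuum. -/
theorem irCompactness_of_stubs
    (hScales : ∀ (G : Type) [Group G] [TopologicalSpace G] [IsTopologicalGroup G] [CompactSpace G]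
      [MeasurableSpace G] [BorelSpace G] (r : LatticeRep G) (β : ℝ) (A B : YMSpecies G),
      ¬ (∀ p : ℕ, ∃ C : ℝ, ∀ n : ℕ, ∃ S₀ : ℕ, ∀ S : ℕ, S₀ ≤ S →
          (n : ℝ) ^ p * |latticeConnectedCorr r.ρ β (2 * S + 1) A.F B.F n| ≤ C) →
        ∃ (s₀ : YMSpecies G) (sch : SpeciesScheme (YMSpecies G)),
          IsIRSchemeAt r β sch ∧ IsSingleSpecies sch s₀ ∧ IsNondegenerate r sch ∧
            ∀ σ : Fin 2 → YMSpecies G, IsUniformlyTemperedAt r sch 2 σ)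
    (hNoInt : ∀ (G : Type) [Group G] [TopologicalSpace G] [IsTopologicalGroup G] [CompactSpace G]
      [MeasurableSpace G] [BorelSpace G] (r : LatticeRep G) (β : ℝ) (s₀ : YMSpecies G)
      (sch : SpeciesScheme (YMSpecies G)),
      IsIRSchemeAt r β sch → IsSingleSpecies sch s₀ → IsNondegenerate r sch →
        (∀ σ : Fin 2 → YMSpecies G, IsUniformlyTemperedAt r sch 2 σ) →
          ∃ (s₁ : YMSpecies G) (sch' : SpeciesScheme (YMSpecies G)),
            IsIRSchemeAt r β sch' ∧ IsSingleSpecies sch' s₁ ∧ IsNondegenerate r sch' ∧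
              ∀ n : ℕ, n ≠ 0 → ∀ σ : Fin n → YMSpecies G, IsUniformlyTemperedAt r sch' n σ)
    (hExtract : ∀ (G : Type) [Group G] [TopologicalSpace G] [IsTopologicalGroup G] [CompactSpace G]
      [MeasurableSpace G] [BorelSpace G] (r : LatticeRep G) (s₀ : YMSpecies G)
      (sch : SpeciesScheme (YMSpecies G)),
      IsSingleSpecies sch s₀ →
        (∀ n : ℕ, n ≠ 0 → ∀ σ : Fin n → YMSpecies G, IsUniformlyTemperedAt r sch n σ) →
          ∃ φ : ℕ → ℕ, StrictMono φ ∧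
            ∃ S : LabelledSchwingerFamily (YMSpecies G) (EuclideanSpace ℝ (Fin 4)),
              ∀ n : ℕ, n ≠ 0 → ∀ (σ : Fin n → YMSpecies G)
                (f : Fin n → 𝓢(EuclideanSpace ℝ (Fin 4), ℝ))
                (F : 𝓢((Fin n → EuclideanSpace ℝ (Fin 4)), ℂ)),
                IsTensorOf F (fun i => ofRealTest (f i)) → IsOffDiagonal F →
                  Tendsto (fun k : ℕ =>
                    ((latticeSchwinger r.ρ sch (fun s => s.F) (φ k) n σ f : ℝ) : ℂ))
                    atTop (𝓝 (S n σ F))) :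
    -- ↓ the body of `Summit.QuantumFields.YangMills.Theses.InfraredLiouville.IRCompactness`, verbatim
    ∀ (G : Type) [Group G] [TopologicalSpace G] [IsTopologicalGroup G] [CompactSpace G] [MeasurableSpace G] [BorelSpace G] (r : LatticeRep G) (β : ℝ) (A B : YMSpecies G), ¬ (∀ p : ℕ, ∃ C : ℝ, ∀ n : ℕ, ∃ S₀ : ℕ, ∀ S : ℕ, S₀ ≤ S → (n : ℝ) ^ p * |latticeConnectedCorr r.ρ β (2 * S + 1) A.F B.F n| ≤ C) → ∃ (sch : SpeciesScheme (YMSpecies G)) (S : LabelledSchwingerFamily (YMSpecies G) (EuclideanSpace ℝ (Fin 4))), (∀ k : ℕ, sch.β k = β) ∧ (∀ s : YMSpecies G, ∃ (p : ℕ) (K : ℝ), ∀ k : ℕ, |sch.c s k| ≤ K * (sch.a k)⁻¹ ^ p) ∧ (∀ (s : YMSpecies G) (k : ℕ), sch.m s k = ∫ U, s.F (torusLift (sch.side k) U) ∂(wilsonMeasure (d := 4) (L := sch.side k) r.ρ (sch.β k))) ∧ (∀ n : ℕ, n ≠ 0 → ∀ (σ : Fin n → YMSpecies G) (f : Fin n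 → SchwartzMap (EuclideanSpace ℝ (Fin 4)) ℝ) (F : SchwartzMap (Fin n → EuclideanSpace ℝ (Fin 4)) ℂ), IsTensorOf F (fun i => ofRealTest (f i)) → IsOffDiagonal F → Filter.Tendsto (fun k : ℕ => ((latticeSchwinger r.ρ sch (fun s => s.F) k n σ f : ℝ) : ℂ)) Filter.atTop (nhds (S n σ F))) ∧ ∃ n : ℕ, n ≠ 0 ∧ ∃ (σ : Fin n → YMSpecies G) (f : Fin n → SchwartzMap (EuclideanSpace ℝ (Fin 4)) ℝ) (F : SchwartzMap (Fin n → EuclideanSpace ℝ (Fin 4)) ℂ), IsTensorOf F (fun i => ofRealTest (f i)) ∧ IsOffDiagonal F ∧ S n σ F ≠ 0 := by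
  intro G _ _ _ _ _ _ r β A B hdec
  -- good scales for one species, then the no-intermittency upgrade, then extraction
  obtain ⟨s₀, sch, hIR, hss, hnd, h2⟩ := hScales G r β A B hdec
  obtain ⟨s₁, sch', hIR', hss', hnd', hT'⟩ := hNoInt G r β s₀ sch hIR hss hnd h2
  obtain ⟨φ, hφ, S, hconv⟩ := hExtract G r s₁ sch' hss' hT'
  obtain ⟨hβφ, hcφ, hmφ⟩ := hIR'.reindex φ hφ
  refine ⟨reindex sch' φ hφ, S, hβφ, hcφ, hmφ, ?_, ?_⟩
  · -- convergence of ALL joint functions along the subsequence = the extraction stub, verbatim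
    intro n hn σ f F hF hO
    simpa only [latticeSchwinger_reindex] using hconv n hn σ f F hF hO
  · -- the limit is not the vacuum: the uniform lower bound δ passes to the limit
    obtain ⟨n, hn, σ, f, F, hF, hO, δ, hδ, hlow⟩ := hnd'
    refine ⟨n, hn, σ, f, F, hF, hO, ?_⟩
    have hlim := (hconv n hn σ f F hF hO).norm
    have hge : δ ≤ ‖S n σ F‖ :=
      ge_of_tendsto' hlim fun k => by
        rw [Complex.norm_real, Real.norm_eq_abs]
        exact hlow (φ k)
    intro h0
    rw [h0, norm_zero] at hge
    exact absurd hge (not_le.mpr hδ)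

/-- **THE SKELETON THEOREM — the crux BY NAME from the three declared stubs** (the only theorem of
this file headed by `…InfraredLiouville.IRCompactness`; `sorry` occurs only inside `stub_*`). -/
theorem IRCompactness_of : Summit.QuantumFields.YangMills.Theses.InfraredLiouville.IRCompactness :=
  irCompactness_of_stubs stub_twoPointScales stub_noIntermittency stub_extraction

end

end Summit.QuantumFields.YangMills.Cruxes.IRCompactness.Birth
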